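/-
Copyright (c) 2026. All rights reserved.
Released under Apache 2.0 license as described in the file LICENSE.
-/
import Literature.Probability.FitznerVanDerHofstad2017.NobleBoundsNFirstSNe
import Literature.Probability.FitznerVanDerHofstad2017.NobleBoundsNMidSZero
import Literature.Probability.FitznerVanDerHofstad2017.NobleBoundsNMidSOne
import HarnessLib

/-!
# Fitzner–van der Hofstad (2017), §6.1 (6.4) / App. B: the first junction, inner classes `0` and `1`

[FvdH17] = R. Fitzner, R. van der Hofstad, *Generalized approach to the non-backtracking lace expansion*,
arXiv:1506.07977v2 (EJP 22 (2017), paper 43).  Page numbers refer to the arXiv version.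

Continuation of `NobleBoundsNFirstS` / `NobleBoundsNFirstSNe` (first junction, cell `(a_0, 2, 0)`): the packages
of the FIRST junction `k = 0` of the typed (6.4) chain, variant `F‴` on level `1` with exit class `0`, for the
cells `(a_0, c, 0)` with start class `a_0 ∈ {1, 2}` and INNER CLASS `c ∈ {0, 1}` (`c = 0`: `t_0 = z_0`, [FvdH17]
§6.1 "Case b = 0"; `c = 1`: the open sausage bond `t_0 ~ z_0`, "Case b = 1", p. 59).  Targets
`P^{S,a_0}(u_0,w_0) · A^{κ,a_0,c,*}(u_0,w_0,t_0,z_0) · A^{c,0}(t_0,z_0,w_1,u_1)` — the `c`-summand of the `k = 0`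
factor of the pointwise (6.4) ((5.1) p. 46, (5.4) p. 48, App. B pp. 73–75).

§A a FRAME for the first junction (`nonempty_jPkg_firstS_frame`: eight line events with their memberships, a
parameter predicate closing the empty pieces, and three letter bounds ⇒ package), and the START LETTER as an
existential reading (`firstS_startLetter`: for `a_0 ∈ {1,2}` events of the three start lines with memberships and
the bound by `P^{S,a_0}(u_0,w_0)`, from the four cells of `NobleBoundsNFirstSNe`); §B the cells
`nonempty_jPkg_firstS_ne_zero_zero` (`c = 0`) and `nonempty_jPkg_firstS_ne_one_zero` (`c = 1`).

Conventions: `d`-generic; nothing is cited as a fact; additive.  `k₀ = (0 : Fin (M+1)).castSucc`,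
`k₁ = (0 : Fin (M+1)).succ`; the App. B rows are those of `NobleBoundsNMidSZero` / `NobleBoundsNMidSOne`.
-/

noncomputable section

namespace Literature.Probability.FitznerVanDerHofstad2017

open Literature.Barriers.CriticalPhenomena Literature.Probability.Percolation
open Literature.Probability.LatticeModels Literature.Combinatorics.SimpleGraph _root_.SimpleGraph
open _root_.MeasureTheory
open Literature.Probability.FitznerVanDerHofstad2017.NobleBlocks
open Literature.Probability.FitznerVanDerHofstad2017.NobleBlocks.LenIdx
open scoped ENNReal

variable {d : ℕ}

section FirstFacts

variable {M : ℕ} {x : Site d} {b : Fin (M + 2) → Site d × Site d} {w t z : Fin (M + 2) → Site d}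
  {a : Fin (M + 2) → Fin 3 ⊕ Unit} {c : Fin 3 ⊕ Unit} {τ : Fin (M + 1) → Bool × Fin 3}
  {ω : Fin (M + 3) → BondConfig (Site d)} {K₀ : Fin (M + 3) → Fin 6 → Set (Sym2 (Site d))}

/-- The non-coincidence clause of the start level: the top `v_0 = b̄_0` of the first pivotal bond is none of
`0, w_0, z_0`. [cite: FitznerVanDerHofstad2017, (4.57) and the non-coincidence conditions of §4.4 (arXiv:1506.07977v2 pp. 41–43)] -/
theorem JFacts.v_first_notMem (h : JFacts M x b w t z a c τ ω K₀) :
    (b (0 : Fin (M + 1)).castSucc).2 ∉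
      ({(0 : Site d), w (0 : Fin (M + 1)).castSucc, z (0 : Fin (M + 1)).castSucc} : Set (Site d)) :=
  (h.level 0).2.2

/-- At the first junction `v_0 ≠ z_0`. [cite: FitznerVanDerHofstad2017, (4.57) (arXiv:1506.07977v2 p. 41)] -/
theorem JFacts.v_first_ne_z (h : JFacts M x b w t z a c τ ω K₀) :
    (b (0 : Fin (M + 1)).castSucc).2 ≠ z (0 : Fin (M + 1)).castSucc :=
  fun he => h.v_first_notMem (by rw [he]; simp)

end FirstFacts

/-! ### A. The frame of the first junction and the start letter -/

section Packages

variable (p : unitInterval) (M : ℕ) (x : Site d) (b : Fin (M + 2) → Site d × Site d) (w t z : Fin (M + 2) → Site d)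
  (a : Fin (M + 2) → Fin 3 ⊕ Unit) (c : Fin 3 ⊕ Unit) (τ : Fin (M + 1) → Bool × Fin 3)

/-- **Frame of the first junction, variant `F‴`**: given the events of the four start lines and of the four
non-trivial lines `v → t`, `t – z`, `t → w_1`, `z → u_1` of level `1` with their witness memberships under the joint
facts, a parameter predicate `P` implied by the facts (so that the piece is empty off `P`), and bounds of the three
letters of the grouping `glFirstS` (start letter, cross letter, `A`-letter) valid under `P`, the junction has a
package with target the product of the three bounds.
[cite: FitznerVanDerHofstad2017, §6.1 (6.4) (arXiv:1506.07977v2 p. 58); §5.1 (5.4) (p. 48); §4.2 (4.18) (p. 35); §4.4 (4.65) (p. 43)] -/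
theorem nonempty_jPkg_firstS_frame (κ : Fin d × Bool)
    (hb : (b (0 : Fin (M + 1)).castSucc).2 = (b (0 : Fin (M + 1)).castSucc).1 + stepVec κ) (hσ : (τ 0).1 = false)
    {a' : Fin 3} (ha' : a (0 : Fin (M + 1)).succ = Sum.inl a') (P : Prop)
    (hPf : ∀ ω K₀, JFacts M x b w t z a c τ ω K₀ → P) (X0 X1 X2 X3 E0 E1 E2 E3 : Set (BondConfig (Site d)))
    (hX0 : IsFinitary X0) (hX1 : IsFinitary X1) (hX2 : IsFinitary X2) (hX3 : IsFinitary X3) (hE0 : IsFinitary E0)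
    (hE1 : IsFinitary E1) (hE2 : IsFinitary E2) (hE3 : IsFinitary E3)
    (hmem : ∀ ω K₀, JFacts M x b w t z a c τ ω K₀ →
      (K₀ (0 : Fin (M + 1)).castSucc.castSucc 0 ∈ X0 ∧ K₀ (0 : Fin (M + 1)).castSucc.castSucc 1 ∈ X1 ∧
        K₀ (0 : Fin (M + 1)).castSucc.castSucc 2 ∈ X2 ∧ K₀ (0 : Fin (M + 1)).castSucc.castSucc 3 ∈ X3) ∧
      (K₀ (0 : Fin (M + 1)).castSucc.succ 0 ∈ E0 ∧ K₀ (0 : Fin (M + 1)).castSucc.succ 1 ∈ E1 ∧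
        K₀ (0 : Fin (M + 1)).castSucc.succ 2 ∈ E2 ∧ K₀ (0 : Fin (M + 1)).castSucc.succ 3 ∈ E3))
    (TS TA TB : ℝ≥0∞)
    (hTS : P → junF p M x b w t z a τ (0 : Fin (M + 1)).castSucc glFirstS true false
      (firstEv3 (event (eq 1) (b (0 : Fin (M + 1)).castSucc).1 (b (0 : Fin (M + 1)).castSucc).2)
        X0 X1 X2 X3 E0 E1 E2 E3) (.lo 0) ≤ TS)
    (hTA : P → junF p M x b w t z a τ (0 : Fin (M + 1)).castSucc glFirstS true false
      (firstEv3 (event (eq 1) (b (0 : Fin (M + 1)).castSucc).1 (b (0 : Fin (M + 1)).castSucc).2)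
        X0 X1 X2 X3 E0 E1 E2 E3) .xb ≤ TA)
    (hTB : P → junF p M x b w t z a τ (0 : Fin (M + 1)).castSucc glFirstS true false
      (firstEv3 (event (eq 1) (b (0 : Fin (M + 1)).castSucc).1 (b (0 : Fin (M + 1)).castSucc).2)
        X0 X1 X2 X3 E0 E1 E2 E3) (.up 2) ≤ TB) :
    Nonempty (JPkg p (jctx M x b w t z a τ (0 : Fin (M + 1)).castSucc) (JFacts M x b w t z a c τ)
      (TS * (TA * TB))) := by
  by_cases hP : P
  swap
  · exact ⟨JPkg.vacuous p _ _ (fun ω K₀ hF => hP (hPf ω K₀ hF)) _⟩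
  have huv : (b (0 : Fin (M + 1)).castSucc).1 ≠ (b (0 : Fin (M + 1)).castSucc).2 := by
    rw [hb]; exact (zdGraph_adj_iff_stepVec _ _ |>.2 ⟨κ, rfl⟩).ne
  rw [← mul_assoc]
  refine nonempty_jPkg_of_joint p (0 : Fin (M + 1)).castSucc glFirstS true
    (firstEv3 (event (eq 1) (b (0 : Fin (M + 1)).castSucc).1 (b (0 : Fin (M + 1)).castSucc).2)
      X0 X1 X2 X3 E0 E1 E2 E3)
    (isFinitary_firstEv3 _ _ _ _ _ _ _ _ _ (isFinitary_event _ _ _) hX0 hX1 hX2 hX3 hE0 hE1 hE2 hE3)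
    (fun _ => by rw [firstEv3_xb]; exact singleton_mem_event_eq_one huv)
    (fun j j' _ _ hg => glFirstS_entry M x b w t z a τ hσ ha' j j' hg)
    (fun ω K₀ hF => ⟨fun j hj => ?_, fun j hj => ?_⟩) ?_
  · have hj4 : (j : ℕ) < 4 := (jFirst_act_lo_iff M x b w t z a τ true false j).1 hj
    obtain ⟨⟨h0, h1, h2, h3⟩, -⟩ := hmem ω K₀ hF
    exact mem_firstEv3_lo _ _ _ _ _ _ _ _ _ h0 h1 h2 h3 j hj4
  · have hj5 : j ≠ 5 := (jMidS_act_up_iff M x b w t z a τ 0 hσ ha' true false j).1 hj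
    obtain ⟨-, h0, h1, h2, h3⟩ := hmem ω K₀ hF
    exact mem_firstEv3_up _ _ _ _ _ _ _ _ _ h0 h1 h2 h3 j hj5
  · exact (prod_junF_le₃ p M x b w t z a τ (0 : Fin (M + 1)).castSucc glFirstS true false _
      (show JIdx.lo 0 ≠ JIdx.xb by decide) (show JIdx.lo 0 ≠ JIdx.up 2 by decide)
      (show JIdx.xb ≠ JIdx.up 2 by decide)).trans (mul_le_mul' (mul_le_mul' (hTS hP) (hTA hP)) (hTB hP))

/-- **The start letter `P^{S,a_0}(u_0,w_0)`, `a_0 ∈ {1,2}`, as an existential reading**: there are increasing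
finitary events `X0, X1, X2` of the three start lines `0 → u_0`, `0 → w_0`, `w_0 → u_0` containing their witnesses
under the joint facts and such that, whatever the other events, the start letter of `glFirstS` is bounded by
`P^{S,a_0}(u_0,w_0)` once `u_0 ≠ 0`, `u_0 ≠ w_0` (the four readings of `NobleBoundsNFirstSNe`, by `w_0 = 0` /
`w_0 ≠ 0`).
[cite: FitznerVanDerHofstad2017, §6.1 (6.1), (6.4) and the split in w (arXiv:1506.07977v2 pp. 58–59); (4.49) (p. 40); App. B Table P^{S,a} (p. 73)] -/
theorem firstS_startLetter (a₀ : Fin 3) (ha : a (0 : Fin (M + 1)).castSucc = Sum.inl a₀) (ha0 : a₀ ≠ 0) :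
    ∃ X0 X1 X2 : Set (BondConfig (Site d)), IsFinitary X0 ∧ IsFinitary X1 ∧ IsFinitary X2 ∧
      (∀ ω K₀, JFacts M x b w t z a c τ ω K₀ →
        K₀ (0 : Fin (M + 1)).castSucc.castSucc 0 ∈ X0 ∧ K₀ (0 : Fin (M + 1)).castSucc.castSucc 1 ∈ X1 ∧
          K₀ (0 : Fin (M + 1)).castSucc.castSucc 2 ∈ X2) ∧
      ∀ EB X3 E0 E1 E2 E3 : Set (BondConfig (Site d)),
        (b (0 : Fin (M + 1)).castSucc).1 ≠ 0 → (b (0 : Fin (M + 1)).castSucc).1 ≠ w (0 : Fin (M + 1)).castSucc →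
        junF p M x b w t z a τ (0 : Fin (M + 1)).castSucc glFirstS true false (firstEv3 EB X0 X1 X2 X3 E0 E1 E2 E3)
          (.lo 0) ≤ blockPS (Letters.perc d p) a₀ (b (0 : Fin (M + 1)).castSucc).1 (w (0 : Fin (M + 1)).castSucc) := by
  -- the start lines are active members of the letter `lo 0`
  have hact : ∀ j : Fin 6, (j : ℕ) < 3 →
      (jctx M x b w t z a τ (0 : Fin (M + 1)).castSucc).Act true false (.lo j) ∧ glFirstS (.lo j) = .lo 0 := by
    intro j hj
    refine ⟨(jFirst_act_lo_iff M x b w t z a τ true false j).2 (by omega), ?_⟩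
    fin_cases j <;> first | rfl | exact absurd hj (by decide)
  obtain h1 | h2 : a₀ = 1 ∨ a₀ = 2 := by
    fin_cases a₀
    · exact absurd rfl ha0
    · exact Or.inl rfl
    · exact Or.inr rfl
  · subst h1
    by_cases hw0 : w (0 : Fin (M + 1)).castSucc = 0
    · refine ⟨event (ge 3) 0 (b (0 : Fin (M + 1)).castSucc).1, Set.univ, event (eq 1) (b (0 : Fin (M + 1)).castSucc).1 0,
        isFinitary_event _ _ _, isFinitary_univ, isFinitary_event _ _ _, fun ω K₀ hF => ?_,
        fun EB X3 E0 E1 E2 E3 hu0 _ => ?_⟩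
      · have h1c := hF.exitClass_one (0 : Fin (M + 1)).castSucc ha
        have hu0 := hF.u_first_ne_zero ha (by decide)
        have hK2 := hF.wu_witness_first h1c.1.symm (by rw [Sym2.eq_swap]; exact h1c.2.1)
        have h0 := hF.conn_first.1
        have hnm : s((0 : Site d), (b (0 : Fin (M + 1)).castSucc).1) ∉ K₀ (0 : Fin (M + 1)).castSucc.castSucc 0 :=
          fun hm => Set.disjoint_left.1 (hF.disj (0 : Fin (M + 1)).castSucc.castSucc 0 2 (by decide)) hm
            (by rw [hK2, hw0]; exact Set.mem_singleton _)
        have hKE : K₀ (0 : Fin (M + 1)).castSucc.castSucc 0 ⊆ (zdGraph d).edgeSet :=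
          (hF.witness_subset _ 0).trans (hF.lattice _)
        have hadj : (zdGraph d).Adj (0 : Site d) (b (0 : Fin (M + 1)).castSucc).1 := by
          have h' := h1c.2.2; rw [hw0] at h'; exact h'.symm
        refine ⟨?_, Set.mem_univ _, ?_⟩
        · rw [event_ge]
          exact mem_openConnGe_three_of_sdiff hKE hadj (by rwa [Set.sdiff_singleton_eq_self hnm])
        · rw [hK2, hw0, Sym2.eq_swap]; exact singleton_mem_event_eq_one hu0
      · refine (junF_le_of_lines p M x b w t z a τ (0 : Fin (M + 1)).castSucc glFirstS true false _ (JIdx.lo 0)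
          ![JIdx.lo 0, .lo 2] (by decide) (fun m => by fin_cases m <;> exact hact _ (by decide)) ![0, 0]
          (fun m => by fin_cases m <;> rfl)
          ![event (ge 3) 0 (b (0 : Fin (M + 1)).castSucc).1, event (eq 1) (b (0 : Fin (M + 1)).castSucc).1 0]
          (by funext m; fin_cases m <;> rfl)).trans ?_
        rw [hw0]; exact piPerc_start_one_zero_le_blockPS p hu0 _
    · refine ⟨event (ge 1) 0 (b (0 : Fin (M + 1)).castSucc).1, event (ge 1) (w (0 : Fin (M + 1)).castSucc) 0,
        event (eq 1) (b (0 : Fin (M + 1)).castSucc).1 (w (0 : Fin (M + 1)).castSucc),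
        isFinitary_event _ _ _, isFinitary_event _ _ _, isFinitary_event _ _ _, fun ω K₀ hF => ?_,
        fun EB X3 E0 E1 E2 E3 hu0 _ => ?_⟩
      · have h1c := hF.exitClass_one (0 : Fin (M + 1)).castSucc ha
        have hu0 := hF.u_first_ne_zero ha (by decide)
        have hK2 := hF.wu_witness_first h1c.1.symm (by rw [Sym2.eq_swap]; exact h1c.2.1)
        obtain ⟨h0, h1, -⟩ := hF.conn_first
        refine ⟨?_, ?_, ?_⟩
        · rw [event_ge]; exact mem_openConnGe_one_of_ne h0 hu0.symm
        · rw [event_comm, event_ge]; exact mem_openConnGe_one_of_ne h1 (Ne.symm hw0)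
        · rw [hK2, Sym2.eq_swap]; exact singleton_mem_event_eq_one h1c.1
      · refine (junF_le_of_lines p M x b w t z a τ (0 : Fin (M + 1)).castSucc glFirstS true false _ (JIdx.lo 0)
          ![JIdx.lo 0, .lo 2, .lo 1] (by decide) (fun m => by fin_cases m <;> exact hact _ (by decide)) ![0, 0, 0]
          (fun m => by fin_cases m <;> rfl)
          ![event (ge 1) 0 (b (0 : Fin (M + 1)).castSucc).1,
            event (eq 1) (b (0 : Fin (M + 1)).castSucc).1 (w (0 : Fin (M + 1)).castSucc),
            event (ge 1) (w (0 : Fin (M + 1)).castSucc) 0]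
          (by funext m; fin_cases m <;> rfl)).trans ?_
        exact piPerc_start_one_ne_le_blockPS p hu0 hw0 _
  · subst h2
    by_cases hw0 : w (0 : Fin (M + 1)).castSucc = 0
    · refine ⟨event (ge 2) 0 (b (0 : Fin (M + 1)).castSucc).1, Set.univ, event (ge 2) 0 (b (0 : Fin (M + 1)).castSucc).1,
        isFinitary_event _ _ _, isFinitary_univ, isFinitary_event _ _ _, fun ω K₀ hF => ?_,
        fun EB X3 E0 E1 E2 E3 hu0 _ => ?_⟩
      · have h2c := hF.exitClass_two (0 : Fin (M + 1)).castSucc ha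
        have hu0 := hF.u_first_ne_zero ha (by decide)
        have h0 := hF.conn_first.1
        have h2 := hF.conn_first_two
        rw [hw0] at h2
        have hnb : ∀ j : Fin 6,
            s((0 : Site d), (b (0 : Fin (M + 1)).castSucc).1) ∉ K₀ (0 : Fin (M + 1)).castSucc.castSucc j :=
          fun j hm => h2c.2 (by rw [hw0, Sym2.eq_swap]; exact hF.witness_subset _ j hm)
        refine ⟨?_, Set.mem_univ _, ?_⟩
        · rw [event_ge]; exact mem_openConnGe_two_of_notMem h0 hu0.symm (hnb 0)
        · rw [event_ge]; exact mem_openConnGe_two_of_notMem h2 hu0.symm (hnb 2)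
      · refine (junF_le_of_lines p M x b w t z a τ (0 : Fin (M + 1)).castSucc glFirstS true false _ (JIdx.lo 0)
          ![JIdx.lo 0, .lo 2] (by decide) (fun m => by fin_cases m <;> exact hact _ (by decide)) ![0, 0]
          (fun m => by fin_cases m <;> rfl)
          ![event (ge 2) 0 (b (0 : Fin (M + 1)).castSucc).1, event (ge 2) 0 (b (0 : Fin (M + 1)).castSucc).1]
          (by funext m; fin_cases m <;> rfl)).trans ?_
        rw [hw0]; exact piPerc_start_two_zero_le_blockPS p hu0 _ rfl
    · refine ⟨event (ge 1) 0 (b (0 : Fin (M + 1)).castSucc).1, event (ge 1) (w (0 : Fin (M + 1)).castSucc) 0,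
        event (ge 2) (b (0 : Fin (M + 1)).castSucc).1 (w (0 : Fin (M + 1)).castSucc),
        isFinitary_event _ _ _, isFinitary_event _ _ _, isFinitary_event _ _ _, fun ω K₀ hF => ?_,
        fun EB X3 E0 E1 E2 E3 hu0 _ => ?_⟩
      · have h2c := hF.exitClass_two (0 : Fin (M + 1)).castSucc ha
        have hu0 := hF.u_first_ne_zero ha (by decide)
        obtain ⟨h0, h1, -⟩ := hF.conn_first
        have h2 := hF.conn_first_two
        refine ⟨?_, ?_, ?_⟩
        · rw [event_ge]; exact mem_openConnGe_one_of_ne h0 hu0.symm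
        · rw [event_comm, event_ge]; exact mem_openConnGe_one_of_ne h1 (Ne.symm hw0)
        · rw [event_comm, event_ge]
          exact mem_openConnGe_two_of_notMem h2 h2c.1.symm fun hm =>
            h2c.2 (by rw [Sym2.eq_swap]; exact hF.witness_subset _ 2 hm)
      · refine (junF_le_of_lines p M x b w t z a τ (0 : Fin (M + 1)).castSucc glFirstS true false _ (JIdx.lo 0)
          ![JIdx.lo 0, .lo 2, .lo 1] (by decide) (fun m => by fin_cases m <;> exact hact _ (by decide)) ![0, 0, 0]
          (fun m => by fin_cases m <;> rfl)
          ![event (ge 1) 0 (b (0 : Fin (M + 1)).castSucc).1,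
            event (ge 2) (b (0 : Fin (M + 1)).castSucc).1 (w (0 : Fin (M + 1)).castSucc),
            event (ge 1) (w (0 : Fin (M + 1)).castSucc) 0]
          (by funext m; fin_cases m <;> rfl)).trans ?_
        exact piPerc_start_two_ne_le_blockPS p hu0 hw0 _

/-! ### B. The cells `(a_0, 0, 0)` and `(a_0, 1, 0)`, `a_0 ∈ {1, 2}` -/

/-- **First junction, cells `(a_0, 0, 0)`, `a_0 ∈ {1,2}`, variant `F‴`**: inner class `0` (`t_0 = z_0`, the
sausage line of level `1` is trivial) and exit class `0` above (`w_1 = u_1`); target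
`P^{S,a_0}(u_0,w_0) · A^{κ,a_0,0,*}(u_0,w_0,t_0,z_0) · A^{0,0}(t_0,z_0,w_1,u_1)` — the cross letter collects the
bond, `{v_0 ←1→ t_0}` (`v_0 ≠ z_0 = t_0`, non-coincidence of the start level) and the exit line `{t_0 ↔ w_0}` of
level `0`; the `A`-letter is the double connection `{t_0 ⇔ u_1}` (`= 𝒟`, `t_0 ≠ u_1`).
[cite: FitznerVanDerHofstad2017, §6.1 (6.4), "Case a = 1 / a ≥ 2", "Case b = 0" (arXiv:1506.07977v2 pp. 58–59); §5.1 (5.1), (5.4) (pp. 46–48); App. B (pp. 73–75)] -/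
theorem nonempty_jPkg_firstS_ne_zero_zero (κ : Fin d × Bool)
    (hb : (b (0 : Fin (M + 1)).castSucc).2 = (b (0 : Fin (M + 1)).castSucc).1 + stepVec κ) (hσ : (τ 0).1 = false)
    (hc0 : (τ 0).2 = 0) (a₀ : Fin 3) (ha : a (0 : Fin (M + 1)).castSucc = Sum.inl a₀) (ha0 : a₀ ≠ 0)
    (ha' : a (0 : Fin (M + 1)).succ = Sum.inl 0) :
    Nonempty (JPkg p (jctx M x b w t z a τ (0 : Fin (M + 1)).castSucc) (JFacts M x b w t z a c τ)
      (blockPS (Letters.perc d p) a₀ (b (0 : Fin (M + 1)).castSucc).1 (w (0 : Fin (M + 1)).castSucc) *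
        (blockAiotaSt (Letters.perc d p) κ a₀ 0 (b (0 : Fin (M + 1)).castSucc).1 (w (0 : Fin (M + 1)).castSucc)
            (t (0 : Fin (M + 1)).castSucc) (z (0 : Fin (M + 1)).castSucc) *
          blockA (Letters.perc d p) 0 0 (t (0 : Fin (M + 1)).castSucc) (z (0 : Fin (M + 1)).castSucc)
            (w (0 : Fin (M + 1)).succ) (b (0 : Fin (M + 1)).succ).1))) := by
  obtain ⟨X0, X1, X2, hX0, hX1, hX2, hmS, hbS⟩ := firstS_startLetter p M x b w t z a c τ a₀ ha ha0
  refine nonempty_jPkg_firstS_frame p M x b w t z a c τ κ hb hσ ha'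
    (z (0 : Fin (M + 1)).castSucc = t (0 : Fin (M + 1)).castSucc ∧ w (0 : Fin (M + 1)).succ = (b (0 : Fin (M + 1)).succ).1 ∧
      t (0 : Fin (M + 1)).castSucc ≠ (b (0 : Fin (M + 1)).succ).1 ∧ (b (0 : Fin (M + 1)).castSucc).1 ≠ t (0 : Fin (M + 1)).castSucc ∧
      (b (0 : Fin (M + 1)).castSucc).1 ≠ 0 ∧ (b (0 : Fin (M + 1)).castSucc).1 ≠ w (0 : Fin (M + 1)).castSucc ∧
      (a₀ = 1 → (zdGraph d).Adj (b (0 : Fin (M + 1)).castSucc).1 (w (0 : Fin (M + 1)).castSucc)))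
    (fun ω K₀ hF => ?_) X0 X1 X2 (event (ge 0) (t (0 : Fin (M + 1)).castSucc) (w (0 : Fin (M + 1)).castSucc))
    (event (ge 1) (b (0 : Fin (M + 1)).castSucc).2 (t (0 : Fin (M + 1)).castSucc)) Set.univ
    (event (ge 0) (t (0 : Fin (M + 1)).castSucc) (b (0 : Fin (M + 1)).succ).1)
    (event (ge 0) (t (0 : Fin (M + 1)).castSucc) (b (0 : Fin (M + 1)).succ).1)
    hX0 hX1 hX2 (isFinitary_event _ _ _) (isFinitary_event _ _ _) isFinitary_univ (isFinitary_event _ _ _)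
    (isFinitary_event _ _ _) (fun ω K₀ hF => ?_) _ _ _ (fun hP => hbS _ _ _ _ _ _ hP.2.2.2.2.1 hP.2.2.2.2.2.1)
    (fun hP => ?_) (fun hP => ?_)
  · -- the parameter facts of a non-empty piece
    have hv := hF.vac_midS 0 hσ ha'
    exact ⟨(hF.t_eq_z_of_innerClass_zero 0 hc0).symm, hF.w_eq_of_exitClass_zero _ ha', (hF.canon_midS 0 hσ ha').2,
      fun h => hv (by rw [h]; simp), hF.u_first_ne_zero ha ha0, hF.u_ne_w_of_exitClass_ne_zero _ ha ha0,
      fun h1 => (hF.exitClass_one (0 : Fin (M + 1)).castSucc (ha.trans (by rw [h1]))).2.2⟩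
  · -- memberships
    have hzt : z (0 : Fin (M + 1)).castSucc = t (0 : Fin (M + 1)).castSucc := (hF.t_eq_z_of_innerClass_zero 0 hc0).symm
    have hwy := hF.w_eq_of_exitClass_zero _ ha'
    have hvt : (b (0 : Fin (M + 1)).castSucc).2 ≠ t (0 : Fin (M + 1)).castSucc := hzt ▸ hF.v_first_ne_z
    have h3 := hF.conn_first.2.2
    obtain ⟨h0, -, h2, h3', -⟩ := hF.conn_midS 0 hσ ha'
    rw [hzt] at h3 h3'
    rw [hwy] at h2
    refine ⟨⟨(hmS ω K₀ hF).1, (hmS ω K₀ hF).2.1, (hmS ω K₀ hF).2.2, ?_⟩, ?_, Set.mem_univ _, ?_, ?_⟩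
    · rw [event_comm, event_ge]; exact mem_openConnGe_zero_of_mem h3
    · rw [event_ge]; exact mem_openConnGe_one_of_ne h0 hvt
    · rw [event_ge]; exact mem_openConnGe_zero_of_mem h2
    · rw [event_ge]; exact mem_openConnGe_zero_of_mem h3'
  · -- the cross letter `A^{κ,a_0,0,*}`: bond, `v → t`, exit line of level `0`
    obtain ⟨hzt, -, -, hut, -, -, hw1⟩ := hP
    rw [hzt]
    refine (junF_le_of_lines p M x b w t z a τ (0 : Fin (M + 1)).castSucc glFirstS true false _ JIdx.xb
      ![JIdx.xb, .up 0, .lo 3] (by decide) (fun m => ?_) ![0, 1, 0] (fun m => by fin_cases m <;> rfl)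
      ![event (eq 1) (b (0 : Fin (M + 1)).castSucc).1 (b (0 : Fin (M + 1)).castSucc).2,
        event (ge 1) (b (0 : Fin (M + 1)).castSucc).2 (t (0 : Fin (M + 1)).castSucc),
        event (ge 0) (t (0 : Fin (M + 1)).castSucc) (w (0 : Fin (M + 1)).castSucc)]
      (by funext m; fin_cases m <;> rfl)).trans ?_
    · fin_cases m
      · exact ⟨rfl, rfl⟩
      · exact ⟨(jMidS_act_up_iff M x b w t z a τ 0 hσ ha' true false 0).2 (by decide), rfl⟩
      · exact ⟨(jFirst_act_lo_iff M x b w t z a τ true false 3).2 (by decide), rfl⟩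
    · obtain h1 | h2 : a₀ = 1 ∨ a₀ = 2 := by
        fin_cases a₀
        · exact absurd rfl ha0
        · exact Or.inl rfl
        · exact Or.inr rfl
      · subst h1
        obtain ⟨κ', hκ'⟩ := (zdGraph_adj_iff_stepVec _ _).1 (hw1 rfl)
        exact piPerc_midS_one_zero_le_blockAiotaSt p hb hκ' hut.symm _
      · subst h2
        exact piPerc_midS_two_zero_le_blockAiotaSt p hb _
  · -- the `A`-letter `A^{0,0}`: the double connection `t_0 ⇔ u_1` on level `1`
    obtain ⟨hzt, hwy, hty, -⟩ := hP
    rw [hwy, hzt]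
    refine (junF_le_of_lines p M x b w t z a τ (0 : Fin (M + 1)).castSucc glFirstS true false _ (JIdx.up 2)
      ![JIdx.up 2, .up 3] (by decide) (fun m => ?_) ![1, 1] (fun m => by fin_cases m <;> rfl)
      ![event (ge 0) (t (0 : Fin (M + 1)).castSucc) (b (0 : Fin (M + 1)).succ).1,
        event (ge 0) (t (0 : Fin (M + 1)).castSucc) (b (0 : Fin (M + 1)).succ).1]
      (by funext m; fin_cases m <;> rfl)).trans ?_
    · fin_cases m
      · exact ⟨(jMidS_act_up_iff M x b w t z a τ 0 hσ ha' true false 2).2 (by decide), rfl⟩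
      · exact ⟨(jMidS_act_up_iff M x b w t z a τ 0 hσ ha' true false 3).2 (by decide), rfl⟩
    · exact piPerc_midS_zero_zero_le_blockA p hty _ rfl

/-- **First junction, cells `(a_0, 1, 0)`, `a_0 ∈ {1,2}`, variant `F‴`**: inner class `1` (the open sausage bond
`t_0 ~ z_0` of level `1`, its own witness) and exit class `0` above; target
`P^{S,a_0}(u_0,w_0) · A^{κ,a_0,1,*}(u_0,w_0,t_0,z_0) · A^{1,0}(t_0,z_0,w_1,u_1)`.
[cite: FitznerVanDerHofstad2017, §6.1 (6.4), "Case a = 1 / a ≥ 2", "Case b = 1" (arXiv:1506.07977v2 pp. 58–59); §5.1 (5.1), (5.4) (pp. 46–48); App. B (pp. 73–75)] -/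
theorem nonempty_jPkg_firstS_ne_one_zero (κ : Fin d × Bool)
    (hb : (b (0 : Fin (M + 1)).castSucc).2 = (b (0 : Fin (M + 1)).castSucc).1 + stepVec κ) (hσ : (τ 0).1 = false)
    (hc1 : (τ 0).2 = 1) (a₀ : Fin 3) (ha : a (0 : Fin (M + 1)).castSucc = Sum.inl a₀) (ha0 : a₀ ≠ 0)
    (ha' : a (0 : Fin (M + 1)).succ = Sum.inl 0) :
    Nonempty (JPkg p (jctx M x b w t z a τ (0 : Fin (M + 1)).castSucc) (JFacts M x b w t z a c τ)
      (blockPS (Letters.perc d p) a₀ (b (0 : Fin (M + 1)).castSucc).1 (w (0 : Fin (M + 1)).castSucc) *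
        (blockAiotaSt (Letters.perc d p) κ a₀ 1 (b (0 : Fin (M + 1)).castSucc).1 (w (0 : Fin (M + 1)).castSucc)
            (t (0 : Fin (M + 1)).castSucc) (z (0 : Fin (M + 1)).castSucc) *
          blockA (Letters.perc d p) 1 0 (t (0 : Fin (M + 1)).castSucc) (z (0 : Fin (M + 1)).castSucc)
            (w (0 : Fin (M + 1)).succ) (b (0 : Fin (M + 1)).succ).1))) := by
  obtain ⟨X0, X1, X2, hX0, hX1, hX2, hmS, hbS⟩ := firstS_startLetter p M x b w t z a c τ a₀ ha ha0
  refine nonempty_jPkg_firstS_frame p M x b w t z a c τ κ hb hσ ha'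
    ((zdGraph d).Adj (t (0 : Fin (M + 1)).castSucc) (z (0 : Fin (M + 1)).castSucc) ∧
      w (0 : Fin (M + 1)).succ = (b (0 : Fin (M + 1)).succ).1 ∧
      t (0 : Fin (M + 1)).castSucc ≠ (b (0 : Fin (M + 1)).succ).1 ∧ z (0 : Fin (M + 1)).castSucc ≠ (b (0 : Fin (M + 1)).succ).1 ∧
      (b (0 : Fin (M + 1)).castSucc).1 ≠ 0 ∧ (b (0 : Fin (M + 1)).castSucc).1 ≠ w (0 : Fin (M + 1)).castSucc ∧
      (a₀ = 1 → (zdGraph d).Adj (b (0 : Fin (M + 1)).castSucc).1 (w (0 : Fin (M + 1)).castSucc)))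
    (fun ω K₀ hF => ?_) X0 X1 X2 (event (ge 0) (z (0 : Fin (M + 1)).castSucc) (w (0 : Fin (M + 1)).castSucc))
    (event (ge 0) (b (0 : Fin (M + 1)).castSucc).2 (t (0 : Fin (M + 1)).castSucc))
    (event (eq 1) (t (0 : Fin (M + 1)).castSucc) (z (0 : Fin (M + 1)).castSucc))
    (event (ge 1) (t (0 : Fin (M + 1)).castSucc) (b (0 : Fin (M + 1)).succ).1)
    (event (ge 1) (b (0 : Fin (M + 1)).succ).1 (z (0 : Fin (M + 1)).castSucc))
    hX0 hX1 hX2 (isFinitary_event _ _ _) (isFinitary_event _ _ _) (isFinitary_event _ _ _) (isFinitary_event _ _ _)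
    (isFinitary_event _ _ _) (fun ω K₀ hF => ?_) _ _ _ (fun hP => hbS _ _ _ _ _ _ hP.2.2.2.2.1 hP.2.2.2.2.2.1)
    (fun hP => ?_) (fun hP => ?_)
  · -- the parameter facts of a non-empty piece
    exact ⟨(hF.innerClass_one 0 hc1).2.2, hF.w_eq_of_exitClass_zero _ ha', (hF.canon_midS 0 hσ ha').2,
      (hF.canon_midS 0 hσ ha').1, hF.u_first_ne_zero ha ha0, hF.u_ne_w_of_exitClass_ne_zero _ ha ha0,
      fun h1 => (hF.exitClass_one (0 : Fin (M + 1)).castSucc (ha.trans (by rw [h1]))).2.2⟩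
  · -- memberships
    have htz : t (0 : Fin (M + 1)).castSucc ≠ z (0 : Fin (M + 1)).castSucc := (hF.innerClass_one 0 hc1).1
    have hK := hF.tz_witness_midS 0 hσ ha' htz (hF.innerClass_one 0 hc1).2.1
    have hwy := hF.w_eq_of_exitClass_zero _ ha'
    obtain ⟨hzy, hty⟩ := hF.canon_midS 0 hσ ha'
    have h3 := hF.conn_first.2.2
    obtain ⟨h0, -, h2, h3', -⟩ := hF.conn_midS 0 hσ ha'
    rw [hwy] at h2
    refine ⟨⟨(hmS ω K₀ hF).1, (hmS ω K₀ hF).2.1, (hmS ω K₀ hF).2.2, ?_⟩, ?_, ?_, ?_, ?_⟩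
    · rw [event_comm, event_ge]; exact mem_openConnGe_zero_of_mem h3
    · rw [event_ge]; exact mem_openConnGe_zero_of_mem h0
    · rw [hK]; exact singleton_mem_event_eq_one htz
    · rw [event_ge]; exact mem_openConnGe_one_of_ne h2 hty
    · rw [event_comm, event_ge]; exact mem_openConnGe_one_of_ne h3' hzy
  · -- the cross letter `A^{κ,a_0,1,*}`: bond, `v → t`, the open sausage bond, exit line of level `0`
    obtain ⟨-, -, -, -, -, -, hw1⟩ := hP
    refine (junF_le_of_lines p M x b w t z a τ (0 : Fin (M + 1)).castSucc glFirstS true false _ JIdx.xb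
      ![JIdx.xb, .up 0, .up 1, .lo 3] (by decide) (fun m => ?_) ![0, 1, 1, 0] (fun m => by fin_cases m <;> rfl)
      ![event (eq 1) (b (0 : Fin (M + 1)).castSucc).1 (b (0 : Fin (M + 1)).castSucc).2,
        event (ge 0) (b (0 : Fin (M + 1)).castSucc).2 (t (0 : Fin (M + 1)).castSucc),
        event (eq 1) (t (0 : Fin (M + 1)).castSucc) (z (0 : Fin (M + 1)).castSucc),
        event (ge 0) (z (0 : Fin (M + 1)).castSucc) (w (0 : Fin (M + 1)).castSucc)]
      (by funext m; fin_cases m <;> rfl)).trans ?_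
    · fin_cases m
      · exact ⟨rfl, rfl⟩
      · exact ⟨(jMidS_act_up_iff M x b w t z a τ 0 hσ ha' true false 0).2 (by decide), rfl⟩
      · exact ⟨(jMidS_act_up_iff M x b w t z a τ 0 hσ ha' true false 1).2 (by decide), rfl⟩
      · exact ⟨(jFirst_act_lo_iff M x b w t z a τ true false 3).2 (by decide), rfl⟩
    · obtain h1 | h2 : a₀ = 1 ∨ a₀ = 2 := by
        fin_cases a₀
        · exact absurd rfl ha0
        · exact Or.inl rfl
        · exact Or.inr rfl
      · subst h1
        obtain ⟨κ', hκ'⟩ := (zdGraph_adj_iff_stepVec _ _).1 (hw1 rfl)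
        exact piPerc_midS_one_one_le_blockAiotaSt p hb hκ' _
      · subst h2
        exact piPerc_midS_two_one_le_blockAiotaSt p hb _
  · -- the `A`-letter `A^{1,0}`: `t_0 → u_1`, `u_1 → z_0` on level `1`, `z_0 ~ t_0`
    obtain ⟨hadj, hwy, -⟩ := hP
    obtain ⟨κ', hκ'⟩ := (zdGraph_adj_iff_stepVec _ _).1 hadj
    rw [hwy]
    refine (junF_le_of_lines p M x b w t z a τ (0 : Fin (M + 1)).castSucc glFirstS true false _ (JIdx.up 2)
      ![JIdx.up 2, .up 3] (by decide) (fun m => ?_) ![1, 1] (fun m => by fin_cases m <;> rfl)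
      ![event (ge 1) (t (0 : Fin (M + 1)).castSucc) (b (0 : Fin (M + 1)).succ).1,
        event (ge 1) (b (0 : Fin (M + 1)).succ).1 (z (0 : Fin (M + 1)).castSucc)]
      (by funext m; fin_cases m <;> rfl)).trans ?_
    · fin_cases m
      · exact ⟨(jMidS_act_up_iff M x b w t z a τ 0 hσ ha' true false 2).2 (by decide), rfl⟩
      · exact ⟨(jMidS_act_up_iff M x b w t z a τ 0 hσ ha' true false 3).2 (by decide), rfl⟩
    · exact piPerc_midS_one_zero_le_blockA p hκ' _

end Packages

end Literature.Probability.FitznerVanDerHofstad2017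

end
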